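import Summits.CriticalPhenomena.PercolationContinuityZ3.Theorems.Transplant.SkelPhiRootRoute
import Summits.CriticalPhenomena.PercolationContinuityZ3.Theorems.Transplant.SkelPhiRunExitGoals
import Summits.CriticalPhenomena.PercolationContinuityZ3.Theorems.Transplant.SkelStepIVInputs
import HarnessLib

/-!
# N1 (the `{±1}` node), (R) column ((R6d); NEG-SCOPE B.13): THE BRIDGE DATA OF THE ROOT CHAIN IN THE THREE ORIENTATION CASES —
# the bridge frame `BridgePrm` (landing box of the hop `[n_L] × [σh_L, σh_L + ℓ_L]`, siting radius `R′`, displacement box and prism bound of the bridge stride) and the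
# bridge stride's sets `(Qb, Fb)` at every centre, with the four facts the (R6c) theorems `rootOblTWAt_negBS_x/_y` ask (`hQb`, `hFb`, `hFZ`, `hbridge`):
# * `bridgeSame σ nL hL ℓL R' nb hb ℓb` — case `o_b = o_L`: stride = the x side half of `φ` (advance `n_b`);
# * `bridgeTrSide …` — case `o_b ≠ o_L`, steep: the x side half of `trφ φ` with `σ' = σ·sgnz h_b` (advance `≥ |h_b|`);
# * `bridgeTrTop …` — case `o_b ≠ o_L`, flat: the top piece of `trφ φ` (advance `≥ ℓ_b − |h_b| − 11`);
# each with `BridgeOK` (`ℓ_b ≥ 3`) and **`bridgeData_same/_trSide/_trTop`**: from the served Step-I″ inputs of the bridge pair at every centre (all eight pieces of the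
# bridge pair's own map `φB`) the readings `hQb/hFb/hFZ` (via `bridgeSets_*`) and the certificate `hbridge`

builds on p205010 (kernel theorem, internal audit signed; external expert review pending) — nothing in this file uses p205010; nothing here is a claim about the open node.
Lane `prim-bschramm`, seat `prim-bschramm-p3` (gen 9; design owner + (R) owner); helper file (`--supports stmt-CriticalPhenomena-4575 --as helper`).
[cite: KozmaNitzan2024, §4 p. 28, Lemma 10 Step IV (pp. 20–21)] [cite: MartineauTassion2017, §3.2]
-/

noncomputable section

open scoped Classical

namespace Summit.CriticalPhenomena.PercolationContinuityZ3.Theorems.Transplant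

namespace Skelφ

open MeasureTheory Literature.Probability.Percolation Literature.Probability.LatticeModels SimpleGraph KNLevels
open Literature.Barriers.CriticalPhenomena (graphBall graphBall_mono)
open ChainPlanar

variable {V : Type} {G : SimpleGraph V} [G.LocallyFinite] {φ : V → Site 2}

/-! ## §1 The three bridge frames -/

/-- **Bridge frame, case `o_b = o_L`.** [this work] -/
def bridgeSame (σ : ℤ) (nL : ℕ) (hL : ℤ) (ℓL R' nb : ℕ) (hb : ℤ) (ℓb : ℕ) : BridgePrm :=
  ⟨pt nL (σ * hL), pt nL (σ * hL + ℓL), R', pt nb (σ * hb), pt nb (σ * hb + ℓb), pgScale nb hb (3 * ℓb)⟩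

/-- **Bridge frame, case `o_b ≠ o_L`, steep** (`s = sgnz h_b`). [this work] -/
def bridgeTrSide (σ : ℤ) (nL : ℕ) (hL : ℤ) (ℓL R' nb : ℕ) (hb : ℤ) (ℓb : ℕ) : BridgePrm :=
  ⟨pt nL (σ * hL), pt nL (σ * hL + ℓL), R', pt |hb| (σ * sgnz hb * nb), pt (|hb| + ℓb) (σ * sgnz hb * nb), pgScale nb hb (3 * ℓb)⟩

/-- **Bridge frame, case `o_b ≠ o_L`, flat.** [this work] -/
def bridgeTrTop (σ : ℤ) (nL : ℕ) (hL : ℤ) (ℓL R' nb : ℕ) (hb : ℤ) (ℓb : ℕ) : BridgePrm :=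
  ⟨pt nL (σ * hL), pt nL (σ * hL + ℓL), R', pt ((ℓb : ℤ) - |hb| - 11) (-(nb : ℤ)), pt ((ℓb : ℤ) + |hb|) nb, pgScale nb hb (3 * ℓb)⟩

omit [G.LocallyFinite] in
/-- `n ≤ pgScale n h ℓ` and `ℓ + |h| ≤ pgScale n h ℓ`, as integers. [folklore] -/
theorem le_pgScale_int (n : ℕ) (h : ℤ) (ℓ : ℕ) : (n : ℤ) ≤ pgScale n h ℓ ∧ (ℓ : ℤ) + |h| ≤ pgScale n h ℓ := by
  unfold pgScale
  constructor
  · exact_mod_cast le_max_left _ _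
  · have h3 : ((ℓ + h.natAbs : ℕ) : ℤ) ≤ ((max n (ℓ + h.natAbs) : ℕ) : ℤ) := by exact_mod_cast le_max_right _ _
    push_cast at h3 ⊢
    exact h3

omit [G.LocallyFinite] in
/-- The three bridge frames are admissible (`ℓ_b ≥ 3`; `σ = ±1`). [folklore] -/
theorem bridgeOK_all {σ : ℤ} (hσ : σ = 1 ∨ σ = -1) (nL : ℕ) (hL : ℤ) (ℓL R' nb : ℕ) (hb : ℤ) {ℓb : ℕ} (hℓb : 3 ≤ ℓb) :
    BridgeOK (bridgeSame σ nL hL ℓL R' nb hb ℓb) ∧ BridgeOK (bridgeTrSide σ nL hL ℓL R' nb hb ℓb) ∧ BridgeOK (bridgeTrTop σ nL hL ℓL R' nb hb ℓb) := by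
  obtain ⟨hn, hℓh⟩ := le_pgScale_int nb hb (3 * ℓb)
  have hσabs : |σ| = 1 := by rcases hσ with h | h <;> simp [h]
  have hs := sgnz_cases hb
  have hshb : |σ * hb| = |hb| := by rw [abs_mul, hσabs, one_mul]
  have hsn : |σ * sgnz hb * nb| = nb := by
    rw [abs_mul, abs_mul, hσabs, one_mul, show |sgnz hb| = 1 by rcases hs with h | h <;> simp [h], one_mul, Nat.abs_cast]
  have h0 : pt (nL : ℤ) (σ * hL) ≤ pt nL (σ * hL + ℓL) := fun i => by fin_cases i <;> simp [pt] 
  have hab1 := abs_le.1 (le_of_eq hshb)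
  have hab2 := abs_le.1 (le_of_eq hsn)
  push_cast at hℓh
  refine ⟨⟨h0, fun i => ?_, fun i => ?_⟩, ⟨h0, fun i => ?_, fun i => ?_⟩, ⟨h0, fun i => ?_, fun i => ?_⟩⟩ <;>
    fin_cases i <;> simp only [bridgeSame, bridgeTrSide, bridgeTrTop, pt_zero, pt_one, Fin.zero_eta, Fin.isValue, Fin.mk_one] <;>
    (try constructor) <;> linarith [hab1.1, hab1.2, hab2.1, hab2.2, abs_nonneg hb]

/-! ## §2 The bridge data at every centre from the served inputs -/

/-- The coercion of `pgramPrismFin` (local copy of the `StepI` lemma). [folklore] -/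
theorem coe_pgramPrismFin' (ψ : V → Site 2) (c : V) (n : ℕ) (h : ℤ) (ℓ R : ℕ) :
    (↑(pgramPrismFin G ψ c n h ℓ R) : Set V) = pgramPrism G ψ c n h ℓ R := by
  ext w; simp


section Data

variable (t : V) {σ : ℤ} (hσ : σ = 1 ∨ σ = -1) (nL : ℕ) (hL : ℤ) (ℓL R' : ℕ) {nb : ℕ} (hnb : 1 ≤ nb) (hb : ℤ) (ℓb Rb : ℕ) (vb : ℤ)
  {φB : V → Site 2} {Λ : V → ℕ → Finset V} {kz Mz : ℕ} {q : unitInterval} {δ : ℝ}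
  (hZ : ∀ c, (↑(Λ c Mz) : Set V) ⊆ cyl φ c Mz)
  (hserved : ∀ (c : V) (σ' τ' : ℤ), (σ' = 1 ∨ σ' = -1) → (τ' = 1 ∨ τ' = -1) →
    1 - δ < (bondPercolation G q).real (linkIn (pgramPrism G φB c nb hb (3 * ℓb) Rb) (Λ c kz) (pgSideHalfW G φB c nb hb ℓb Rb σ' τ')) ∧
    1 - δ < (bondPercolation G q).real (linkIn (pgramPrism G φB c nb hb (3 * ℓb) Rb) (Λ c kz) (pgTopPieceW G φB c nb hb ℓb Rb σ' τ' vb)))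
include hσ hnb hZ hserved

/-- **Case `o_b = o_L`** (`φB = φ`): region = the bridge prism, piece = the x side half `(σ, 1)` of `φ`. [cite: KozmaNitzan2024, §4 Lemma 10 Step IV] -/
theorem bridgeData_same (hMz : Mz < nb) (hφ : φB = φ) :
    (∀ c, ∀ w ∈ pgramPrismFin G φ c nb hb (3 * ℓb) Rb, w ∈ graphBall G c Rb ∧
      rootFrame φ t σ w ∈ Finset.Icc (rootFrame φ t σ c - (((bridgeSame σ nL hL ℓL R' nb hb ℓb).pr : ℕ) : Site 2))
        (rootFrame φ t σ c + (((bridgeSame σ nL hL ℓL R' nb hb ℓb).pr : ℕ) : Site 2))) ∧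
    (∀ c, ∀ w ∈ pgSideHalfW G φ c nb hb ℓb Rb σ 1, w ∈ pgramPrismFin G φ c nb hb (3 * ℓb) Rb ∧
      rootFrame φ t σ w ∈ Finset.Icc (rootFrame φ t σ c + (bridgeSame σ nL hL ℓL R' nb hb ℓb).dlo) (rootFrame φ t σ c + (bridgeSame σ nL hL ℓL R' nb hb ℓb).dhi)) ∧
    (∀ c, Disjoint (pgSideHalfW G φ c nb hb ℓb Rb σ 1) (Λ c Mz)) ∧
    (∀ c, 1 - δ < (bondPercolation G q).real (linkIn (↑(pgramPrismFin G φ c nb hb (3 * ℓb) Rb) : Set V) (Λ c kz) (pgSideHalfW G φ c nb hb ℓb Rb σ 1))) := by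
  subst hφ
  have key := fun c => bridgeSets_same (G := G) (φ := φB) t hσ (bridgeSame σ nL hL ℓL R' nb hb ℓb) (c := c) hnb (h := hb) (ℓ := ℓb) (Rb := Rb) (τ := 1)
    (Or.inl rfl) le_rfl (by simp [bridgeSame]) (by simp [bridgeSame]) (hZ c) hMz
  refine ⟨fun c => (key c).1, fun c => (key c).2.1, fun c => (key c).2.2, fun c => ?_⟩
  rw [coe_pgramPrismFin']
  exact ((hserved c σ 1 hσ (Or.inl rfl))).1

/-- **Case `o_b ≠ o_L`, steep** (`φB = trφ φ`): piece = the x side half `(σ·sgnz h_b, σ)` of `trφ φ`. [cite: KozmaNitzan2024, §4 Lemma 10 Step IV] -/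
theorem bridgeData_trSide (hMz : Mz < nb) (hφ : φB = trφ φ) :
    (∀ c, ∀ w ∈ pgramPrismFin G (trφ φ) c nb hb (3 * ℓb) Rb, w ∈ graphBall G c Rb ∧
      rootFrame φ t σ w ∈ Finset.Icc (rootFrame φ t σ c - (((bridgeTrSide σ nL hL ℓL R' nb hb ℓb).pr : ℕ) : Site 2))
        (rootFrame φ t σ c + (((bridgeTrSide σ nL hL ℓL R' nb hb ℓb).pr : ℕ) : Site 2))) ∧
    (∀ c, ∀ w ∈ pgSideHalfW G (trφ φ) c nb hb ℓb Rb (σ * sgnz hb) σ, w ∈ pgramPrismFin G (trφ φ) c nb hb (3 * ℓb) Rb ∧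
      rootFrame φ t σ w ∈ Finset.Icc (rootFrame φ t σ c + (bridgeTrSide σ nL hL ℓL R' nb hb ℓb).dlo) (rootFrame φ t σ c + (bridgeTrSide σ nL hL ℓL R' nb hb ℓb).dhi)) ∧
    (∀ c, Disjoint (pgSideHalfW G (trφ φ) c nb hb ℓb Rb (σ * sgnz hb) σ) (Λ c Mz)) ∧
    (∀ c, 1 - δ < (bondPercolation G q).real
      (linkIn (↑(pgramPrismFin G (trφ φ) c nb hb (3 * ℓb) Rb) : Set V) (Λ c kz) (pgSideHalfW G (trφ φ) c nb hb ℓb Rb (σ * sgnz hb) σ))) := by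
  subst hφ
  have hs := sgnz_cases hb
  have hσs : σ * sgnz hb = 1 ∨ σ * sgnz hb = -1 := by rcases hσ with h | h <;> rcases hs with h' | h' <;> simp [h, h']
  have key := fun c => bridgeSets_tr_side (G := G) (φ := φ) t hσ (bridgeTrSide σ nL hL ℓL R' nb hb ℓb) (c := c) hnb (h := hb) (ℓ := ℓb) (Rb := Rb)
    hs (sgnz_mul_self hb) le_rfl (by simp [bridgeTrSide]) (by simp [bridgeTrSide]) (hZ c) hMz
  refine ⟨fun c => (key c).1, fun c => (key c).2.1, fun c => (key c).2.2, fun c => ?_⟩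
  rw [coe_pgramPrismFin']
  exact ((hserved c (σ * sgnz hb) σ hσs hσ)).1

/-- **Case `o_b ≠ o_L`, flat** (`φB = trφ φ`): piece = the top piece `(σ, 1, v_b)` of `trφ φ` (`|h_b| ≤ 10 n_b`, zone clearance). [cite: KozmaNitzan2024, §4 Lemma 10 Step IV] -/
theorem bridgeData_trTop (hφ : φB = trφ φ) (hκ : hb.natAbs ≤ 10 * nb) (hclr : (Mz + 4) * (nb + hb.natAbs) ≤ nb * (ℓb + 1)) :
    (∀ c, ∀ w ∈ pgramPrismFin G (trφ φ) c nb hb (3 * ℓb) Rb, w ∈ graphBall G c Rb ∧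
      rootFrame φ t σ w ∈ Finset.Icc (rootFrame φ t σ c - (((bridgeTrTop σ nL hL ℓL R' nb hb ℓb).pr : ℕ) : Site 2))
        (rootFrame φ t σ c + (((bridgeTrTop σ nL hL ℓL R' nb hb ℓb).pr : ℕ) : Site 2))) ∧
    (∀ c, ∀ w ∈ pgTopPieceW G (trφ φ) c nb hb ℓb Rb σ 1 vb, w ∈ pgramPrismFin G (trφ φ) c nb hb (3 * ℓb) Rb ∧
      rootFrame φ t σ w ∈ Finset.Icc (rootFrame φ t σ c + (bridgeTrTop σ nL hL ℓL R' nb hb ℓb).dlo) (rootFrame φ t σ c + (bridgeTrTop σ nL hL ℓL R' nb hb ℓb).dhi)) ∧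
    (∀ c, Disjoint (pgTopPieceW G (trφ φ) c nb hb ℓb Rb σ 1 vb) (Λ c Mz)) ∧
    (∀ c, 1 - δ < (bondPercolation G q).real
      (linkIn (↑(pgramPrismFin G (trφ φ) c nb hb (3 * ℓb) Rb) : Set V) (Λ c kz) (pgTopPieceW G (trφ φ) c nb hb ℓb Rb σ 1 vb))) := by
  subst hφ
  have key := fun c => bridgeSets_tr_top (G := G) (φ := φ) t hσ (bridgeTrTop σ nL hL ℓL R' nb hb ℓb) (c := c) hnb (h := hb) hκ (ℓ := ℓb) (Rb := Rb)
    (τ := 1) (v := vb) le_rfl (by simp [bridgeTrTop]) (by simp [bridgeTrTop]) (hZ c) hclr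
  refine ⟨fun c => (key c).1, fun c => (key c).2.1, fun c => (key c).2.2, fun c => ?_⟩
  rw [coe_pgramPrismFin']
  exact ((hserved c σ 1 hσ (Or.inl rfl))).2

end Data

end Skelφ

end Summit.CriticalPhenomena.PercolationContinuityZ3.Theorems.Transplant

end
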